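import Summits.QuantumFields.YangMills.Theorems.BalabanUVNodesN07ChartHValued
import Summits.QuantumFields.YangMills.Theorems.BalabanUVNodesN07ChartHInvTwisted
import Summits.QuantumFields.YangMills.Theorems.BalabanUVNodesN07ChartHInvTwistedTerr
import HarnessLib

/-!
# BalabanUVNodes ∕ N07 — THE ROUTE's RIGHT INVERSE `H` OF THE TRUE LINEARISATION, `𝔤`-VALUED **AND** WITH ALL ITS TWISTED (46)∕(161) LETTERS: the Hermitian symmetrisation + trace
# projection `H ↦ H♮` transfers EVERY pointwise-weighted letter with the factor `3` — the seam between the decay packages and the reality packages of this lane, closed at the operator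

Cell `pub-ymgap`, width seat `pub-ymgap-dag-n07-w2` generation 6 (HUMAN RULING D-0149; DAG node N07 = [15] = [Balaban1985Variational]; W-SEAT START LIST §n07 item 2 = S2
«[15] Sect. C (47)–(49), Prop. 3 at objects»; generation 5's located seam (L3)∕trigger (t3): «a single package with decay AND reality would need the herm0-symmetrisation
`H♮ = P₀∘H′ + H′∘(1−P₀)` run on the twisted letters (factor 3) — not typed»).  `--kind proof --supports stmt-QuantumFields-27364 --as helper` (K1⁹ face per KEY MAP v2; count-neutral).
CONSUMED BY NAME, nothing modified: generation 3's `N07ChartHValued.fderiv_chartLog_zero_comp_linear` (`D chartLog(0)` commutes with every `ℝ`-linear fibre map) and the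
CONSTRUCTION of `N07ChartHValued.exists_herm0Valued_rightInverse` re-run with an ARBITRARY pointwise-weighted letter in place of the sup letter; generation 4's
`N07ChartHInvTwisted.exists_rightInverse_chartLog_twisted` (the route's `H = H₀X̃′ + dφ` on the pinned `flatH` with P2's kernel rows: identity, sup letter, ALL twisted letters);
lit-balaban `MatrixNorms.norm_ntr_le_opNorm`, `B9AdOrthogonal.herm0`; Mathlib `Matrix.l2_opNorm_conjTranspose`.

THE PRINT.  [15] p. 285: «We consider configurations A′, X with values in the complexified Lie algebra 𝔤ᶜ» ((51)) and «A with values in 𝔤»; (45)–(46) `LʲηQ_jHB = B`, `|HB| ≦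
B₀(Lʲη)^{−1}|B|`; (161) p. 303 the exponential kernel bound of `H`.  Print's `H` (the Landau-gauge minimiser) is real AND has a decaying kernel; the tree's route builds `H` from
the flat `GQ*(QGQ*)⁻¹` plus a pure gauge (generation 4) and separately symmetrises for reality (generation 3) — this file shows the symmetrised operator KEEPS every twisted letter.

WHAT IS PROVED (sorry-free; no definition; axioms standard).
§1 ★★★ `exists_herm0Valued_rightInverse_letters` — for a nested family `D`, ANY ℂ-linear right inverse `H` of `D(chartLog η D)(0)`: there is a ℂ-linear `H♮` with
   `D(chartLog η D)(0) ∘ H♮ = id`, mapping Hermitian-traceless data to Hermitian-traceless fields, such that EVERY pointwise-weighted letter of `H` — `(∀ i, ν(i)‖X i‖ ≤ t) ⇒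
   ∀ b, ω(b)‖HX(b)‖ ≤ B·t` with weights `ω, ν ≥ 0` — holds for `H♮` with `3B` (`H♮ = P₀∘H′ + H′∘(1 − P₀)`, `H′ = ½(H + †∘H∘†)`, `P₀ = 1 − N⁻¹tr(·)·1`; `‖X†‖ = ‖X‖`, `‖P₀X‖ ≤
   2‖X‖`, `‖X − P₀X‖ ≤ ‖X‖`).
§2 ★★★ `exists_rightInverse_chartLog_twisted_herm0` — generation 4's `exists_rightInverse_chartLog_twisted` (binders VERBATIM: `(P, k)`, (2.2)-admissible `D`, `IsFlatH` + P2's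
   `HKernelRows` + `RowSum162` over a bipartite `dBI ≥ 0`) ⇒ a ℂ-linear right inverse of `D chartLog(0)` that is `𝔤`-VALUED ON `𝔤`-VALUED DATA and carries the sup letter AND
   every twisted letter of generation 4 with the factor `3`: `e^{δdE(b)}w₁(b)‖HX(b)‖ ≤ 3·C_KB₃(1+2Ce^{δr₁})(1+2C(1+L)e^{δr₂})·t` whenever `e^{δdF(c)}‖X(c)‖ ≤ t` — the displayed
   letter `hHe` of `N07ChartDDecay.chartD_fderiv_twisted_le` AND the hypothesis `hSH` of `N07ChartLogReality.chartD_valued_herm0` ON ONE OPERATOR.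
§3 ★★★ `exists_rightInverse_chartLog_twisted_terr_herm0` — the same on generation 4's `_terr` interface (block slack at the territory level `levOf x`, the premise a
   MULTISCALE-distance twist satisfies).
NOT HERE (successor, by name): the END-TO-END re-run of `N07ChartHInvTwisted.exists_chartD_decay_of_kernelRows` ∕ `…DecayAtRecord` ∕ `…RefBond` ∕ `…Analytic` ∕ generation 5–6's
expansions on THIS `H` (their proofs obtain `H` internally; the H-parametric cores `chartD_fderiv_twisted_le`, `exists_chartD_hasFDerivAt`, `chartD_valued_herm0` apply to §2's `H`
as they stand).

HONEST FRAMING: count-neutral helper; linear algebra of `†` and the trace projection against weighted sup letters (generation 3's construction, re-run) — NO new estimate of [15];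
nothing of Sects. D–F; stub 1 ∕ K0⁷ ∕ K1⁹ NOT closed; N07 NOT discharged; counts unmoved; one finite T⁴ programme at fixed ε — NOT continuum ∕ ℝ⁴ ∕ OS ∕ mass gap ∕ Clay: the
Yang–Mills mass gap is NOT proved by any of this; R4 closes the conditional rung `BalabanLadder.UV` only.  No `sorry`, no `def`, no `instance`, no `notation`.

References: [15] T. Bałaban, CMP 102 (1985) 277–309 [Balaban1985Variational] ((45)–(46), (51) p.285, (152) p.301, (156)–(157) p.302, (161) p.303); [B7] CMP 98 (1985) 17–51
[Balaban1985Averaging] ((20) p.21).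
-/

noncomputable section

open scoped BigOperators Matrix.Norms.L2Operator
open NormedSpace Metric Set

namespace Summit.QuantumFields.YangMills.BalabanUVNodes.N07ChartHInvTwistedHerm0

open Literature.MathematicalPhysics.QuantumFieldTheory.Balaban1983to89
open Literature.MathematicalPhysics.QuantumFieldTheory.Balaban1983to89.T4Continuum (T4Family)
open Literature.MathematicalPhysics.QuantumFieldTheory.Balaban1983to89.B6SectADomainsV1 (Domains)
open Literature.MathematicalPhysics.QuantumFieldTheory.Balaban1983to89.B6SectAOperatorsV1 (BondIdx)
open Literature.MathematicalPhysics.QuantumFieldTheory.Balaban1983to89.B9AdOrthogonal (herm0 mem_herm0)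
open B5Eq118OneStroke (iterBlockOf)
open MatrixNorms (norm_ntr_le_opNorm)
open Summit.QuantumFields.YangMills.Theorems.FlatCubeOpsText (Adm22)
open Summit.QuantumFields.YangMills.Theorems.K0FlatCubeOpsTextP (IsFlatH IsLevWeight HKernelRows RowSum162 levWeight_nonneg)
open Summit.QuantumFields.YangMills.Theorems.Prop8Chart (chartLog)
open Summit.QuantumFields.YangMills.BalabanUVNodes.N07ChartHValued (fderiv_chartLog_zero_comp_linear)
open Summit.QuantumFields.YangMills.BalabanUVNodes.N07ChartHInvTwisted (exists_rightInverse_chartLog_twisted)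
open Summit.QuantumFields.YangMills.BalabanUVNodes.N07ChartHInvTwistedTerr (exists_rightInverse_chartLog_twisted_terr)
open B11Eq115Space (levOf)

variable {P : Params} {N : ℕ} [NeZero N]

/-! ## §1 The symmetrisation transfers every pointwise-weighted letter -/

/-- ★★★ **A `𝔤`-VALUED RIGHT INVERSE FROM ANY RIGHT INVERSE, KEEPING EVERY POINTWISE-WEIGHTED LETTER (factor `3`).**  For a nested family `D` and a ℂ-linear `H` with
`D(chartLog η D)(0) ∘ H = id` (`η = L^{−k}`): there is a ℂ-linear `H♮` with `D(chartLog η D)(0) ∘ H♮ = id`, mapping Hermitian traceless data to Hermitian traceless fields, such that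
for ALL weights `ω ≥ 0` on fine bonds, `ν ≥ 0` on indices and every constant `B`: if `(∀ i, ν i·‖X i‖ ≤ t) ⇒ ∀ b, ω b·‖HX b‖ ≤ B·t` (all `X`, `t ≥ 0`), then the same holds for `H♮`
with `3B` — generation 3's `H♮ = P₀∘H′ + H′∘(1 − P₀)`, `H′ = ½(H + †∘H∘†)`, whose three pieces cost `B`, `2B`, `B` against pointwise weights since `†` is an isometry of the fibre,
`‖P₀X‖ ≤ 2‖X‖` and `‖X − P₀X‖ ≤ ‖X‖`. [cite: Balaban1985Variational, (45)-(46) p.285, (51) p.285, (161) p.303; Balaban1985Averaging, (20) p.21] -/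
theorem exists_herm0Valued_rightInverse_letters (k : ℕ) (D : Domains P)
    (H : (BondIdx D → Matrix (Fin N) (Fin N) ℂ) →ₗ[ℂ] (PBond P 0 → Matrix (Fin N) (Fin N) ℂ))
    (hHinv : ∀ X, (fderiv ℂ (chartLog (((P.L : ℝ)⁻¹) ^ k) D : (PBond P 0 → Matrix (Fin N) (Fin N) ℂ) → BondIdx D → Matrix (Fin N) (Fin N) ℂ) 0) (H X) = X) :
    ∃ H' : (BondIdx D → Matrix (Fin N) (Fin N) ℂ) →ₗ[ℂ] (PBond P 0 → Matrix (Fin N) (Fin N) ℂ),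
      (∀ X, (fderiv ℂ (chartLog (((P.L : ℝ)⁻¹) ^ k) D : (PBond P 0 → Matrix (Fin N) (Fin N) ℂ) → BondIdx D → Matrix (Fin N) (Fin N) ℂ) 0) (H' X) = X) ∧
      (∀ X : BondIdx D → Matrix (Fin N) (Fin N) ℂ, (∀ i, X i ∈ herm0 (Fin N)) → ∀ b, H' X b ∈ herm0 (Fin N)) ∧
      ∀ (ω : PBond P 0 → ℝ) (ν : BondIdx D → ℝ) (B : ℝ), (∀ b, 0 ≤ ω b) → (∀ i, 0 ≤ ν i) →
        (∀ (X : BondIdx D → Matrix (Fin N) (Fin N) ℂ) (t : ℝ), 0 ≤ t → (∀ i, ν i * ‖X i‖ ≤ t) → ∀ b, ω b * ‖H X b‖ ≤ B * t) →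
        ∀ (X : BondIdx D → Matrix (Fin N) (Fin N) ℂ) (t : ℝ), 0 ≤ t → (∀ i, ν i * ‖X i‖ ≤ t) → ∀ b, ω b * ‖H' X b‖ ≤ 3 * B * t := by
  -- adapted from generation 3's `N07ChartHValued.exists_herm0Valued_rightInverse` (same construction; the letter is now a parameter)
  set Qlin := (fderiv ℂ (chartLog (((P.L : ℝ)⁻¹) ^ k) D : (PBond P 0 → Matrix (Fin N) (Fin N) ℂ) → BondIdx D → Matrix (Fin N) (Fin N) ℂ) 0) with hQlin
  have hcard : (0 : ℝ) < Fintype.card (Fin N) := by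
    rw [Fintype.card_fin]; exact_mod_cast Nat.pos_of_ne_zero (NeZero.ne N)
  -- the two `ℝ`-linear fibre maps: conjugate transpose `†` and the trace projection `P₀`
  let σ : Matrix (Fin N) (Fin N) ℂ →ₗ[ℝ] Matrix (Fin N) (Fin N) ℂ :=
    { toFun := fun X => star X
      map_add' := fun X Y => star_add X Y
      map_smul' := fun r X => by
        rw [RingHom.id_apply, Matrix.star_eq_conjTranspose, Matrix.star_eq_conjTranspose, Matrix.conjTranspose_smul, star_trivial] }
  have hσ : ∀ X, σ X = star X := fun _ => rfl
  let P₀ : Matrix (Fin N) (Fin N) ℂ →ₗ[ℂ] Matrix (Fin N) (Fin N) ℂ :=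
    LinearMap.id - ((Fintype.card (Fin N) : ℂ)⁻¹ • (Matrix.traceLinearMap (Fin N) ℂ ℂ).smulRight (1 : Matrix (Fin N) (Fin N) ℂ))
  have hP₀ : ∀ X, P₀ X = X - ((Fintype.card (Fin N) : ℂ)⁻¹ * X.trace) • (1 : Matrix (Fin N) (Fin N) ℂ) := fun X => by
    simp only [P₀, LinearMap.sub_apply, LinearMap.id_apply, LinearMap.smul_apply, LinearMap.smulRight_apply, Matrix.traceLinearMap_apply, smul_smul]
  have hP₀_herm0 : ∀ X : Matrix (Fin N) (Fin N) ℂ, X.IsHermitian → P₀ X ∈ herm0 (Fin N) := by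
    intro X hX
    rw [mem_herm0, hP₀]
    refine ⟨?_, ?_⟩
    · have htr : star X.trace = X.trace := by rw [← Matrix.trace_conjTranspose, hX.eq]
      unfold Matrix.IsHermitian
      rw [Matrix.conjTranspose_sub, hX.eq, Matrix.conjTranspose_smul, Matrix.conjTranspose_one, star_mul', htr, star_inv₀, Complex.star_def,
        Complex.conj_natCast]
    · have hN : (N : ℂ) ≠ 0 := by exact_mod_cast NeZero.ne N
      rw [Matrix.trace_sub, Matrix.trace_smul, Matrix.trace_one, Fintype.card_fin, smul_eq_mul, mul_assoc, mul_comm X.trace, ← mul_assoc,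
        inv_mul_cancel₀ hN, one_mul, sub_self]
  have hP₀_fix : ∀ X : Matrix (Fin N) (Fin N) ℂ, X.trace = 0 → P₀ X = X := fun X hX => by
    rw [hP₀, hX, mul_zero, zero_smul, sub_zero]
  have hP₀_norm : ∀ X : Matrix (Fin N) (Fin N) ℂ, ‖P₀ X‖ ≤ 2 * ‖X‖ := fun X => by
    rw [hP₀]
    have h1 : ‖((Fintype.card (Fin N) : ℂ)⁻¹ * X.trace) • (1 : Matrix (Fin N) (Fin N) ℂ)‖ ≤ ‖X‖ := by
      rw [norm_smul, norm_one, mul_one, inv_mul_eq_div]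
      exact norm_ntr_le_opNorm X
    calc ‖X - ((Fintype.card (Fin N) : ℂ)⁻¹ * X.trace) • (1 : Matrix (Fin N) (Fin N) ℂ)‖
        ≤ ‖X‖ + ‖((Fintype.card (Fin N) : ℂ)⁻¹ * X.trace) • (1 : Matrix (Fin N) (Fin N) ℂ)‖ := norm_sub_le _ _
      _ ≤ 2 * ‖X‖ := by linarith
  have hP₀_compl : ∀ X : Matrix (Fin N) (Fin N) ℂ, ‖X - P₀ X‖ ≤ ‖X‖ := fun X => by
    rw [hP₀, sub_sub_cancel, norm_smul, norm_one, mul_one, inv_mul_eq_div]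
    exact norm_ntr_le_opNorm X
  -- `H₁ := † ∘ H ∘ †` is ℂ-linear
  let H₁ : (BondIdx D → Matrix (Fin N) (Fin N) ℂ) →ₗ[ℂ] (PBond P 0 → Matrix (Fin N) (Fin N) ℂ) :=
    { toFun := fun X b => star (H (fun i => star (X i)) b)
      map_add' := fun X Y => by
        funext b
        have h : (fun i => star ((X + Y) i)) = (fun i => star (X i)) + (fun i => star (Y i)) := by
          funext i; simp only [Pi.add_apply, star_add]
        rw [h, map_add]; simp only [Pi.add_apply, star_add]
      map_smul' := fun c X => by
        funext b
        have h : (fun i => star ((c • X) i)) = (star c) • (fun i => star (X i)) := by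
          funext i; simp only [Pi.smul_apply, star_smul]
        rw [h, map_smul]; simp only [Pi.smul_apply, RingHom.id_apply, star_smul, star_star] }
  have hH₁ : ∀ X b, H₁ X b = star (H (fun i => star (X i)) b) := fun _ _ => rfl
  -- `H′ := ½ (H + H₁)`, then `H♮ := P₀∘H′ + H′∘(1 − P₀)`
  let H' : (BondIdx D → Matrix (Fin N) (Fin N) ℂ) →ₗ[ℂ] (PBond P 0 → Matrix (Fin N) (Fin N) ℂ) := (((1 / 2 : ℝ) : ℂ)) • (H + H₁)
  have hH' : ∀ X b, H' X b = ((1 / 2 : ℝ) : ℂ) • (H X b + star (H (fun i => star (X i)) b)) := fun X b => by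
    show (((1 / 2 : ℝ) : ℂ) • ((H + H₁) X)) b = _
    rw [Pi.smul_apply, LinearMap.add_apply, Pi.add_apply, hH₁]
  let Hn : (BondIdx D → Matrix (Fin N) (Fin N) ℂ) →ₗ[ℂ] (PBond P 0 → Matrix (Fin N) (Fin N) ℂ) :=
    (P₀.compLeft (PBond P 0)).comp H' + H'.comp ((LinearMap.id - P₀).compLeft (BondIdx D))
  have hHn : ∀ X b, Hn X b = P₀ (H' X b) + H' (fun i => X i - P₀ (X i)) b := fun X b => by
    show (P₀.compLeft (PBond P 0) (H' X) + H' ((LinearMap.id - P₀).compLeft (BondIdx D) X)) b = _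
    rw [Pi.add_apply, LinearMap.compLeft_apply, Function.comp_apply]
    rfl
  -- the right-inverse property
  have hinvH₁ : ∀ X, Qlin (H₁ X) = X := fun X => by
    funext idx
    have h := fderiv_chartLog_zero_comp_linear (((P.L : ℝ)⁻¹) ^ k) D σ (H (fun i => star (X i))) idx
    have hfun : (fun b => σ (H (fun i => star (X i)) b)) = H₁ X := funext fun b => by rw [hσ, hH₁]
    rw [hfun] at h
    rw [h, hHinv, hσ, star_star]
  have hinvH' : ∀ X, Qlin (H' X) = X := fun X => by
    show Qlin ((((1 / 2 : ℝ) : ℂ)) • ((H + H₁) X)) = X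
    rw [map_smul, LinearMap.add_apply, map_add, hHinv, hinvH₁, ← two_smul ℂ X, smul_smul]
    norm_num
  have hinvP₀ : ∀ Y : PBond P 0 → Matrix (Fin N) (Fin N) ℂ, ∀ idx, Qlin (fun b => P₀ (Y b)) idx = P₀ (Qlin Y idx) := fun Y idx =>
    fderiv_chartLog_zero_comp_linear (((P.L : ℝ)⁻¹) ^ k) D (P₀.restrictScalars ℝ) Y idx
  have hinvHn : ∀ X, Qlin (Hn X) = X := fun X => by
    funext idx
    have hfun : Hn X = (fun b => P₀ (H' X b)) + H' (fun i => X i - P₀ (X i)) := funext fun b => by rw [hHn]; rfl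
    rw [hfun, map_add, Pi.add_apply, hinvP₀, hinvH', hinvH']
    simp only [add_sub_cancel]
  refine ⟨Hn, hinvHn, fun X hX b => ?_, fun ω ν B hω hν hHB X t ht hX b => ?_⟩
  · -- Hermitian traceless data give Hermitian traceless fields
    rw [hHn]
    have hX0 : (fun i => X i - P₀ (X i)) = 0 := funext fun i => by
      rw [Pi.zero_apply, hP₀_fix (X i) ((mem_herm0).1 (hX i)).2, sub_self]
    rw [hX0, map_zero, Pi.zero_apply, add_zero]
    refine hP₀_herm0 _ ?_
    have hXs : (fun i => star (X i)) = X := funext fun i => by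
      rw [Matrix.star_eq_conjTranspose]; exact ((mem_herm0).1 (hX i)).1.eq
    unfold Matrix.IsHermitian
    rw [hH', hXs, Complex.coe_smul, Matrix.conjTranspose_smul, star_trivial, Matrix.conjTranspose_add, ← Matrix.star_eq_conjTranspose,
      ← Matrix.star_eq_conjTranspose, star_star, add_comm]
  · -- the letter `(ω, ν, B)` of `H` gives the letter `(ω, ν, 3B)` of `H♮`
    have hletH' : ∀ (X : BondIdx D → Matrix (Fin N) (Fin N) ℂ) (t : ℝ), 0 ≤ t → (∀ i, ν i * ‖X i‖ ≤ t) → ∀ b, ω b * ‖H' X b‖ ≤ B * t := by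
      intro X t ht hX b
      have h1 := hHB X t ht hX b
      have h2 := hHB (fun i => star (X i)) t ht (fun i => by
        rw [Matrix.star_eq_conjTranspose, Matrix.l2_opNorm_conjTranspose]; exact hX i) b
      rw [hH', Complex.coe_smul, norm_smul, Real.norm_eq_abs, abs_of_nonneg (by norm_num : (0 : ℝ) ≤ 1 / 2)]
      have h3 : ‖H X b + star (H (fun i => star (X i)) b)‖ ≤ ‖H X b‖ + ‖H (fun i => star (X i)) b‖ := by
        refine (norm_add_le _ _).trans ?_
        rw [Matrix.star_eq_conjTranspose, Matrix.l2_opNorm_conjTranspose]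
      nlinarith [mul_le_mul_of_nonneg_left h3 (hω b)]
    rw [hHn]
    have h1 : ω b * ‖P₀ (H' X b)‖ ≤ 2 * (B * t) := by
      have := mul_le_mul_of_nonneg_left (hP₀_norm (H' X b)) (hω b)
      nlinarith [hletH' X t ht hX b]
    have h2 : ω b * ‖H' (fun i => X i - P₀ (X i)) b‖ ≤ B * t :=
      hletH' (fun i => X i - P₀ (X i)) t ht (fun i => le_trans (mul_le_mul_of_nonneg_left (hP₀_compl (X i)) (hν i)) (hX i)) b
    have h3 : ω b * ‖P₀ (H' X b) + H' (fun i => X i - P₀ (X i)) b‖ ≤ ω b * ‖P₀ (H' X b)‖ + ω b * ‖H' (fun i => X i - P₀ (X i)) b‖ := by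
      rw [← mul_add]; exact mul_le_mul_of_nonneg_left (norm_add_le _ _) (hω b)
    linarith

/-! ## §2 The route's `H`: `𝔤`-valued, with the sup letter and all twisted letters -/

/-- ★★★ **THE ROUTE's RIGHT INVERSE OF `D chartLog(0)`, `𝔤`-VALUED ON `𝔤`-VALUED DATA, WITH THE SUP LETTER AND EVERY TWISTED LETTER (factor `3`).**  Binders VERBATIM those of
`N07ChartHInvTwisted.exists_rightInverse_chartLog_twisted`: a nested family `D` (`D.k = k`), (2.2)-admissible with `2L ≤ R·M + 1`, the level weights `w`, the pinned `flatH`-type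
`H₀` (`IsFlatH`) with P2's kernel rows `HKernelRows … C_K δ₀` and `RowSum162 … δ₀ B₃` over a bipartite `dBI ≥ 0`.  Conclusion: a ℂ-linear `H` with (i) `D chartLog(0) ∘ H = id`;
(ii) the weighted sup letter `w₁(b)‖HX(b)‖ ≤ 3·C_KB₃(1+2C)(1+2C(1+L))·‖X‖_∞`; (iii) for EVERY twist pair `dE∕dF`, `0 ≤ δ ≤ ½δ₀`, with triangle against `dBI`, index slack `r₁`,
block slack `r₂`: `e^{δdE(b)}w₁(b)‖HX(b)‖ ≤ 3·C_KB₃(1+2Ce^{δr₁})(1+2C(1+L)e^{δr₂})·t` whenever `e^{δdF(c)}‖X(c)‖ ≤ t`; (iv) Hermitian-traceless data ↦ Hermitian-traceless fields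
— (iii) is the displayed `hHe` of `N07ChartDDecay.chartD_fderiv_twisted_le`, (iv) the `hSH` of `N07ChartLogReality.chartD_valued_herm0`, ON ONE OPERATOR.
[cite: Balaban1985Variational, (45)-(46) p.285, (51) p.285, (161)-(162) p.303; Balaban1984PropagatorsII, Cor. 2.8 (2.150)-(2.151) p.249] -/
theorem exists_rightInverse_chartLog_twisted_herm0 (k : ℕ) (D : Domains P) (hDk : D.k = k) {R M : ℕ} (hAdm : Adm22 D R M) (hRM : 2 * P.L ≤ R * M + 1)
    (w : ℕ → PBond P 0 → ℝ) (hw : IsLevWeight P k D w) (H₀ : (BondIdx D → ℝ) →ₗ[ℝ] (PBond P 0 → ℝ)) (hH₀ : IsFlatH P k D H₀)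
    (dBI : PBond P 0 → BondIdx D → ℝ) (hd0 : ∀ b c, 0 ≤ dBI b c) {CK δ₀ B₃ : ℝ} (hCK : 0 ≤ CK) (hδ₀ : 0 ≤ δ₀) (hB₃ : 0 ≤ B₃)
    (hker : HKernelRows P k D dBI w H₀ CK δ₀) (h162 : RowSum162 P k D dBI w δ₀ B₃) :
    ∃ H : (BondIdx D → Matrix (Fin N) (Fin N) ℂ) →ₗ[ℂ] (PBond P 0 → Matrix (Fin N) (Fin N) ℂ),
      (∀ X : BondIdx D → Matrix (Fin N) (Fin N) ℂ,
          (fderiv ℂ (chartLog (((P.L : ℝ)⁻¹) ^ k) D : (PBond P 0 → Matrix (Fin N) (Fin N) ℂ) → BondIdx D → Matrix (Fin N) (Fin N) ℂ) 0) (H X) = X) ∧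
      (∀ (X : BondIdx D → Matrix (Fin N) (Fin N) ℂ) (t : ℝ), 0 ≤ t → (∀ i, ‖X i‖ ≤ t) → ∀ b,
        w 1 b * ‖H X b‖ ≤ 3 * (CK * B₃ * (1 + 2 * ((P.d + 2) * P.L : ℕ)) * (1 + 2 * ((P.d + 2) * P.L : ℕ) * (1 + P.L))) * t) ∧
      (∀ (dE : PBond P 0 → ℝ) (dF : BondIdx D → ℝ) (δ r₁ r₂ : ℝ), 0 ≤ δ → δ ≤ δ₀ / 2 →
        (∀ b c, dE b ≤ dBI b c + dF c) →
        (∀ (i c : BondIdx D) (x : Site P 0),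
          (iterBlockOf (i.1.1 : ℕ) x = i.1.2.src ∨ iterBlockOf (i.1.1 : ℕ) x = i.1.2.tgt) →
          (iterBlockOf (c.1.1 : ℕ) x = c.1.2.src ∨ iterBlockOf (c.1.1 : ℕ) x = c.1.2.tgt) → dF i ≤ dF c + r₁) →
        (∀ (b b' : PBond P 0) (x : Site P 0) (j : ℕ), (x = b.src ∨ x = b.tgt) → j ≤ D.k →
          iterBlockOf j b'.src = iterBlockOf j x → dE b ≤ dE b' + r₂) →
        ∀ (X : BondIdx D → Matrix (Fin N) (Fin N) ℂ) (t : ℝ), 0 ≤ t → (∀ c, Real.exp (δ * dF c) * ‖X c‖ ≤ t) → ∀ b : PBond P 0,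
          Real.exp (δ * dE b) * (w 1 b * ‖H X b‖) ≤
            3 * (CK * B₃ * (1 + 2 * ((P.d + 2) * P.L : ℕ) * Real.exp (δ * r₁)) * (1 + 2 * ((P.d + 2) * P.L : ℕ) * (1 + P.L) * Real.exp (δ * r₂))) * t) ∧
      (∀ X : BondIdx D → Matrix (Fin N) (Fin N) ℂ, (∀ i, X i ∈ herm0 (Fin N)) → ∀ b, H X b ∈ herm0 (Fin N)) := by
  obtain ⟨H, hinv, hsup, htw⟩ := exists_rightInverse_chartLog_twisted (n := Fin N) k D hDk hAdm hRM w hw H₀ hH₀ dBI hd0 hCK hδ₀ hB₃ hker h162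
  obtain ⟨H', hinv', hherm, htrans⟩ := exists_herm0Valued_rightInverse_letters k D H hinv
  have hw0 : ∀ b, 0 ≤ w 1 b := levWeight_nonneg hw 1
  refine ⟨H', hinv', ?_, ?_, hherm⟩
  · -- the sup letter (weights `w₁`, input weights `1`)
    intro X t ht hX b
    have h := htrans (w 1) (fun _ => (1 : ℝ)) _ hw0 (fun _ => zero_le_one)
      (fun Y s hs hY c => hsup Y s hs (fun i => by simpa using hY i) c) X t ht (fun i => by simpa using hX i) b
    linarith [h]
  · -- every twisted letter (weights `e^{δdE}w₁`, input weights `e^{δdF}`)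
    intro dE dF δ r₁ r₂ hδ hδh htri hF hE X t ht hX b
    have h := htrans (fun b => Real.exp (δ * dE b) * w 1 b) (fun c => Real.exp (δ * dF c)) _
      (fun b => mul_nonneg (Real.exp_pos _).le (hw0 b)) (fun c => (Real.exp_pos _).le)
      (fun Y s hs hY c => by
        have h' := htw dE dF δ r₁ r₂ hδ hδh htri hF hE Y s hs hY c
        rw [← mul_assoc] at h'
        exact h') X t ht hX b
    rw [mul_assoc] at h
    linarith [h]

/-! ## §3 The same on the territory-level block slack (generation 4's `_terr` interface, for MULTISCALE-distance twists) -/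

/-- ★★★ The `𝔤`-valued right inverse with every twisted letter, block slack read as a TERRITORY-LEVEL premise (`iterBlockOf (levOf x) b′₋ = iterBlockOf (levOf x) x → dE(b) ≤
dE(b′) + r₂`) — `N07ChartHInvTwistedTerr.exists_rightInverse_chartLog_twisted_terr` (binders VERBATIM) symmetrised by §1: identity, sup letter ×3, every twisted letter ×3,
Hermitian-traceless data ↦ Hermitian-traceless fields. [cite: Balaban1985Variational, (45)-(46) p.285, (161)-(162) p.303; Balaban1984PropagatorsII, (2.1)-(2.4) p.224] -/
theorem exists_rightInverse_chartLog_twisted_terr_herm0 (k : ℕ) (D : Domains P) (hDk : D.k = k) {R M : ℕ} (hAdm : Adm22 D R M) (hRM : 2 * P.L ≤ R * M + 1)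
    (w : ℕ → PBond P 0 → ℝ) (hw : IsLevWeight P k D w) (H₀ : (BondIdx D → ℝ) →ₗ[ℝ] (PBond P 0 → ℝ)) (hH₀ : IsFlatH P k D H₀)
    (dBI : PBond P 0 → BondIdx D → ℝ) (hd0 : ∀ b c, 0 ≤ dBI b c) {CK δ₀ B₃ : ℝ} (hCK : 0 ≤ CK) (hδ₀ : 0 ≤ δ₀) (hB₃ : 0 ≤ B₃)
    (hker : HKernelRows P k D dBI w H₀ CK δ₀) (h162 : RowSum162 P k D dBI w δ₀ B₃) :
    ∃ H : (BondIdx D → Matrix (Fin N) (Fin N) ℂ) →ₗ[ℂ] (PBond P 0 → Matrix (Fin N) (Fin N) ℂ),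
      (∀ X : BondIdx D → Matrix (Fin N) (Fin N) ℂ,
          (fderiv ℂ (chartLog (((P.L : ℝ)⁻¹) ^ k) D : (PBond P 0 → Matrix (Fin N) (Fin N) ℂ) → BondIdx D → Matrix (Fin N) (Fin N) ℂ) 0) (H X) = X) ∧
      (∀ (X : BondIdx D → Matrix (Fin N) (Fin N) ℂ) (t : ℝ), 0 ≤ t → (∀ i, ‖X i‖ ≤ t) → ∀ b,
        w 1 b * ‖H X b‖ ≤ 3 * (CK * B₃ * (1 + 2 * ((P.d + 2) * P.L : ℕ)) * (1 + 2 * ((P.d + 2) * P.L : ℕ) * (1 + P.L))) * t) ∧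
      (∀ (dE : PBond P 0 → ℝ) (dF : BondIdx D → ℝ) (δ r₁ r₂ : ℝ), 0 ≤ δ → δ ≤ δ₀ / 2 →
        (∀ b c, dE b ≤ dBI b c + dF c) →
        (∀ (i c : BondIdx D) (x : Site P 0),
          (iterBlockOf (i.1.1 : ℕ) x = i.1.2.src ∨ iterBlockOf (i.1.1 : ℕ) x = i.1.2.tgt) →
          (iterBlockOf (c.1.1 : ℕ) x = c.1.2.src ∨ iterBlockOf (c.1.1 : ℕ) x = c.1.2.tgt) → dF i ≤ dF c + r₁) →
        (∀ (b b' : PBond P 0) (x : Site P 0), (x = b.src ∨ x = b.tgt) →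
          iterBlockOf (levOf (fun i => {z : Site P 0 | D.InOm i z}) D.k x) b'.src = iterBlockOf (levOf (fun i => {z : Site P 0 | D.InOm i z}) D.k x) x →
          dE b ≤ dE b' + r₂) →
        ∀ (X : BondIdx D → Matrix (Fin N) (Fin N) ℂ) (t : ℝ), 0 ≤ t → (∀ c, Real.exp (δ * dF c) * ‖X c‖ ≤ t) → ∀ b : PBond P 0,
          Real.exp (δ * dE b) * (w 1 b * ‖H X b‖) ≤
            3 * (CK * B₃ * (1 + 2 * ((P.d + 2) * P.L : ℕ) * Real.exp (δ * r₁)) * (1 + 2 * ((P.d + 2) * P.L : ℕ) * (1 + P.L) * Real.exp (δ * r₂))) * t) ∧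
      (∀ X : BondIdx D → Matrix (Fin N) (Fin N) ℂ, (∀ i, X i ∈ herm0 (Fin N)) → ∀ b, H X b ∈ herm0 (Fin N)) := by
  obtain ⟨H, hinv, hsup, htw⟩ := exists_rightInverse_chartLog_twisted_terr (n := Fin N) k D hDk hAdm hRM w hw H₀ hH₀ dBI hd0 hCK hδ₀ hB₃ hker h162
  obtain ⟨H', hinv', hherm, htrans⟩ := exists_herm0Valued_rightInverse_letters k D H hinv
  have hw0 : ∀ b, 0 ≤ w 1 b := levWeight_nonneg hw 1
  refine ⟨H', hinv', ?_, ?_, hherm⟩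
  · intro X t ht hX b
    have h := htrans (w 1) (fun _ => (1 : ℝ)) _ hw0 (fun _ => zero_le_one)
      (fun Y s hs hY c => hsup Y s hs (fun i => by simpa using hY i) c) X t ht (fun i => by simpa using hX i) b
    linarith [h]
  · intro dE dF δ r₁ r₂ hδ hδh htri hF hE X t ht hX b
    have h := htrans (fun b => Real.exp (δ * dE b) * w 1 b) (fun c => Real.exp (δ * dF c)) _
      (fun b => mul_nonneg (Real.exp_pos _).le (hw0 b)) (fun c => (Real.exp_pos _).le)
      (fun Y s hs hY c => by
        have h' := htw dE dF δ r₁ r₂ hδ hδh htri hF hE Y s hs hY c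
        rw [← mul_assoc] at h'
        exact h') X t ht hX b
    rw [mul_assoc] at h
    linarith [h]

end Summit.QuantumFields.YangMills.BalabanUVNodes.N07ChartHInvTwistedHerm0

end
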